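import Literature.IUT.LogVolume.TensorPacketModelScaled
import Literature.IUT.LogVolume.TensorPacketUnramifiedShell
import Literature.IUT.LogVolume.TensorPacketSlotUnion
import HarnessLib

/-!
# Mochizuki's container `p^{−⌈d_I+a_I⌉}·log_p(R_I^×)` at an odd, absolutely unramified prime IS `(R_I)^∼`
# ([IUTchIV] Prop. 1.2 (ii)/(iv), Thm. 1.10 Step (vi) — for the shell of `realPrimePacketM`)

Record-only file (D-0012) of the abc-iut cell (Cor. 3.12 sub-crew, seat abc-iut-c312-3; plan/D9PRIME-OBLIGATIONS.md
row O3 for the MAIN-LINE model `tensorPacketModelM` / `DHData.ofIdelesM` of the planner ruling R6); TAKES NO SIDE.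
Mochizuki, *Inter-universal Teichmüller theory IV* (RIMS ms Apr. 2020 = PRIMS **57** (2021)), Prop. 1.2, kurims
p. 10: "`a_i := (1/e_i)·⌈e_i/(p−2)⌉` if `p > 2` … Thus, if `p > 2` and `e_i ≤ p − 2`, then `a_i = 1/e_i = −b_i`",
(ii) "In particular, `φ((R_I)^∼) ⊆ p^{−⌈d_I+a_I⌉}·log_p(R_I^×)`"; proof of (iv), p. 11: "if `p > 2` and `e_i = 1`
… we have `d_I = 0`, `a_I = −b_I ∈ ℤ`"; proof of Thm. 1.10, Step (vi), p. 29: "the “container of possible images”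
is precisely equal to the tensor product of log-shells … Such an upper bound “`0`”".

WHAT THIS FILE PROVES (theorems only, no definitions, no named facts). `TensorPacketModelScaled.lean` fills the
shell slot of the real prime packet with Mochizuki's container `mShell = p^{−⌈d_I+a_I⌉}·log_p(R_I^×)`
(`realPrimePacketM`). At a prime `p > 2` over which every factor `k_i` is absolutely unramified (`e_i = 1`):
* `dSum_eq_zero_of_unramified`, `aSum_eq_card_of_unramified`, `mShellExp_eq_card_of_unramified` —
  `d_I = 0`, `a_I = |I|`, so `⌈d_I + a_I⌉ = |I|`;
* `mShell_eq_normalizedPacket_of_unramified` — `p^{−|I|}·log_p(R_I^×) = p^{−|I|}·p^{|I|}·R_I = R_I = (R_I)^∼`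
  (`|I| ≥ 2`; abc-iut-S2's `coe_logPacket_eq_smul_integerPacket` and
  `integerPacket_eq_normalizedPacket_of_unramified`) — the sibling of Dupuy–Hilado's
  `inv_two_p_pow_smul_logPacket_eq_normalizedPacket` WITHOUT the unit factor `2^{−|I|}`;
* for the real packet with ANY shell normalisation `c` (`realPrimePacketWith`): the integral structure is
  hull-closed (`realPrimePacketWith_hullLoc_O`) and fixed by unit theta scalars
  (`realPrimePacketWith_peel_O_of_ordv_eq_zero`); for Mochizuki's normalisation the shell IS the integral
  structure at such primes in the degrees `j ≥ 1` (`realPrimePacketM_shell_eq_O`) — the three summand-level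
  facts `hshell`/`hhull`/`hbare`-carrier that `Summit.ABC.IUTFork.DHData.logμ_hullUTheta_eq_zero_of_shell`
  (abc-iut-S2, `LDHHullSupport.lean`) turns into Step (vi)'s "upper bound `0`" (summit side: `LDHTensorHoffM.lean`).
[cite: Mochizuki2012, IUTchIV Prop. 1.2 (ii) p. 10, Prop. 1.4 (iv) p. 13, Thm 1.10 proof Step (vi) p. 29]
[cite: DupuyHilado2025, §4.7, §4.12] [claim: Mochizuki2012, status: disputed] Nothing here concerns Cor. 3.12;
an instance ≠ an endorsement; the companion facts for Dupuy–Hilado's normalisation are abc-iut-c312-d1's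
`LDHTensorStepVI.lean`.
-/

noncomputable section

open Set
open scoped Pointwise

namespace Literature.IUT.LogVolume

/-! ## `⌈d_I + a_I⌉ = |I|` and `mShell = (R_I)^∼` at an odd unramified prime -/

section Packet

variable (p : ℕ) [Fact p.Prime]
variable {I : Type} [Fintype I] [DecidableEq I]
variable (k : I → Type) [∀ i, NontriviallyNormedField (k i)] [∀ i, NormedAlgebra ℚ_[p] (k i)]
  [∀ i, IsUltrametricDist (k i)] [∀ i, ProperSpace (k i)]

omit [DecidableEq I] in
/-- `d_I = 0` when every `e_i = 1` (trivial differents). [cite: Mochizuki2012, IUTchIV Prop. 1.4 (iv) proof p. 11] -/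
theorem dSum_eq_zero_of_unramified (he : ∀ i, absRamificationIdx p (k i) = 1) : dSum p k = 0 := by
  unfold dSum
  exact Finset.sum_eq_zero fun i _ => differentOrd_eq_zero_of_absRamificationIdx_eq_one p (k i) (he i)

omit [DecidableEq I] in
/-- `a_I = |I|` when `p > 2` and every `e_i = 1` (`a_i = 1/e_i = 1`). [cite: Mochizuki2012, IUTchIV Prop. 1.2 p. 10] -/
theorem aSum_eq_card_of_unramified (hp : 2 < p) (he : ∀ i, absRamificationIdx p (k i) = 1) :
    aSum p k = Fintype.card I := by
  unfold aSum
  have h1 : ∀ i, logRadiusA p (absRamificationIdx p (k i)) = 1 := fun i => by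
    rw [he i, logRadiusA_eq hp le_rfl (by omega)]
    simp
  simp only [h1, Finset.sum_const, Finset.card_univ, nsmul_eq_mul, mul_one]

omit [DecidableEq I] in
/-- **`⌈d_I + a_I⌉ = |I|`** when `p > 2` and every `e_i = 1` ("`d_I = 0`, `a_I = −b_I ∈ ℤ`").
[cite: Mochizuki2012, IUTchIV Prop. 1.4 (iv) proof p. 11] -/
theorem mShellExp_eq_card_of_unramified (hp : 2 < p) (he : ∀ i, absRamificationIdx p (k i) = 1) :
    mShellExp p k = Fintype.card I := by
  rw [mShellExp, dSum_eq_zero_of_unramified p k he, aSum_eq_card_of_unramified p k hp he, zero_add]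
  exact Int.ceil_natCast _

/-- **Mochizuki's container IS the integral structure at an odd unramified prime**: for `|I| ≥ 2`, `p > 2`
and every `e_i = 1`, `p^{−⌈d_I+a_I⌉}·log_p(R_I^×) = p^{−|I|}·(p^{|I|}·R_I) = R_I = (R_I)^∼` — the "precisely equal"
of Thm. 1.10 Step (vi) for the container of Prop. 1.2 (ii). [cite: Mochizuki2012, IUTchIV Thm 1.10 proof Step (vi) p. 29] -/
theorem mShell_eq_normalizedPacket_of_unramified (hI : 2 ≤ Fintype.card I) (hp : 2 < p)
    (he : ∀ i, absRamificationIdx p (k i) = 1) :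
    mShell p k = (normalizedPacket p k : Set (PacketAlgebra p k)) := by
  have hpQ : (p : ℚ_[p]) ≠ 0 := by exact_mod_cast (Fact.out : p.Prime).ne_zero
  rw [mShell_eq_const_smul, mShellExp_eq_card_of_unramified p k hp he,
    coe_logPacket_eq_smul_integerPacket p k hp he, smul_smul, zpow_neg, zpow_natCast,
    inv_mul_cancel₀ (pow_ne_zero _ hpQ), one_smul, integerPacket_eq_normalizedPacket_of_unramified p k hI he]

end Packet

/-! ## The real prime packets: hull-closedness and unit invariance of `O_{v⃗}`; the shell of `realPrimePacketM` -/

section Real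

variable {F : Type} [Field F] [NumberField F]
variable (p : ℕ) [Fact p.Prime] (𝔽 : LocalFields F p)
variable (c : (j : ℕ) → (Fin (j + 1) → placesOver F p) → ℚ_[p]) (hc0 : ∀ j e, c j e ≠ 0)
  (hcσ : ∀ (j : ℕ) (σ : Equiv.Perm (Fin (j + 1))) (e : Fin (j + 1) → placesOver F p), c j (e ∘ σ) = c j e)

/-- A unit of `K_{v̲}` in the valuation normalised to `F_v` has norm `1`: `ord_v(t) = 0 ⇒ ‖t‖ = 1`.
[cite: DupuyHilado2025, §3.4] -/
theorem LocalFields.norm_eq_one_of_ordv_eq_zero {v : placesOver F p} (t : (𝔽.k v)ˣ) (ht : 𝔽.ordv t = 0) :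
    ‖(t : 𝔽.k v)‖ = 1 := by
  have hlog : Real.log ‖(t : 𝔽.k v)‖ = 0 := by
    rw [𝔽.log_norm_eq_neg_ordv t, ht]
    simp
  rcases Real.log_eq_zero.mp hlog with h | h | h
  · exact absurd h (norm_ne_zero_iff.mpr t.ne_zero)
  · exact h
  · exact absurd h (by have := norm_nonneg (t : 𝔽.k v); linarith)

/-- `hhull` for the real packet (any shell normalisation): `hull((R_I)^∼) = (R_I)^∼`.
[cite: DupuyHilado2025, §4.12] -/
theorem realPrimePacketWith_hullLoc_O {j : ℕ} (e : Fin (j + 1) → placesOver F p) :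
    (realPrimePacketWith p 𝔽 c hc0 hcσ).hullLoc j e ((realPrimePacketWith p 𝔽 c hc0 hcσ).O j e) =
      (realPrimePacketWith p 𝔽 c hc0 hcσ).O j e := by
  exact packetHull_normalizedPacket p (fun a => 𝔽.k (e a))

/-- A unit theta scalar does not move the bare region (any shell normalisation): `ord_v(t) = 0 ⇒ t·O_{v⃗} = O_{v⃗}`.
[cite: DupuyHilado2025, §3.4, §3.9] -/
theorem realPrimePacketWith_peel_O_of_ordv_eq_zero {j : ℕ} (e : Fin (j + 1) → placesOver F p)
    (t : (𝔽.k (e (Fin.last j)))ˣ) (ht : 𝔽.ordv t = 0) :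
    (realPrimePacketWith p 𝔽 c hc0 hcσ).peel t '' (realPrimePacketWith p 𝔽 c hc0 hcσ).O j e =
      (realPrimePacketWith p 𝔽 c hc0 hcσ).O j e := by
  have h := iota_smul_normalizedPacket_eq_of_norm_eq_one p (fun a => 𝔽.k (e a)) (Fin.last j)
    (LocalFields.norm_eq_one_of_ordv_eq_zero p 𝔽 t ht)
  rw [← Set.image_smul] at h
  exact h

/-- The integral structure of `realPrimePacketM` is `(R_I)^∼`. [cite: DupuyHilado2025, §2.4.5] -/
theorem realPrimePacketM_O (j : ℕ) (e : Fin (j + 1) → placesOver F p) :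
    (realPrimePacketM p 𝔽).O j e =
      (normalizedPacket p (fun i => 𝔽.k (e i)) : Set (PacketAlgebra p (fun i => 𝔽.k (e i)))) := rfl

/-- `hhull` for `realPrimePacketM`: `hull(O_{v⃗}) = O_{v⃗}`. [cite: DupuyHilado2025, §4.12] -/
theorem realPrimePacketM_hullLoc_O {j : ℕ} (e : Fin (j + 1) → placesOver F p) :
    (realPrimePacketM p 𝔽).hullLoc j e ((realPrimePacketM p 𝔽).O j e) = (realPrimePacketM p 𝔽).O j e :=
  realPrimePacketWith_hullLoc_O p 𝔽 _ _ _ e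

/-- Unit theta scalars fix `O_{v⃗}` in `realPrimePacketM`. [cite: DupuyHilado2025, §3.4, §3.9] -/
theorem realPrimePacketM_peel_O_of_ordv_eq_zero {j : ℕ} (e : Fin (j + 1) → placesOver F p)
    (t : (𝔽.k (e (Fin.last j)))ˣ) (ht : 𝔽.ordv t = 0) :
    (realPrimePacketM p 𝔽).peel t '' (realPrimePacketM p 𝔽).O j e = (realPrimePacketM p 𝔽).O j e :=
  realPrimePacketWith_peel_O_of_ordv_eq_zero p 𝔽 _ _ _ e t ht

/-- **`hshell` for `realPrimePacketM`**: at a prime `p > 2` over which every `K_{v̲_a}` is absolutely unramified,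
in the degrees `j ≥ 1` (`|I| = j + 1 ≥ 2`), Mochizuki's container `p^{−⌈d_I+a_I⌉}·log_p(R_I^×)` IS `O_{v⃗} =
(R_I)^∼` — "the “container of possible images” is precisely equal to the tensor product of log-shells".
[cite: Mochizuki2012, IUTchIV Thm 1.10 proof Step (vi) p. 29] -/
theorem realPrimePacketM_shell_eq_O (hp : 2 < p) {j : ℕ} (hj : 1 ≤ j) (e : Fin (j + 1) → placesOver F p)
    (he : ∀ a, absRamificationIdx p (𝔽.k (e a)) = 1) :
    (realPrimePacketM p 𝔽).shell j e = (realPrimePacketM p 𝔽).O j e := by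
  rw [realPrimePacketM_shell, realPrimePacketM_O]
  have hI : 2 ≤ Fintype.card (Fin (j + 1)) := by rw [Fintype.card_fin]; omega
  exact mShell_eq_normalizedPacket_of_unramified p (fun a => 𝔽.k (e a)) hI hp he

end Real

end Literature.IUT.LogVolume

end
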